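import Summits.HodgeConjecture.HodgeConjecture.Theorems.WeilTypeLadderBlochSeed
import Summits.HodgeConjecture.HodgeConjecture.Theorems.WeilTypeLadderDegenerationUp
import Summits.HodgeConjecture.HodgeConjecture.Theorems.WeilTypeLadderSixfoldsSqrtMinus1
import HarnessLib

/-!
# WeilTypeLadder · the `d`-SLICES of item stmt-HodgeConjecture-2524 (`WeilSixfolds`) through every door of the ladder

b2b cell `hweil` (packet `run/shared/lean/b2b/hodge-weil/`, `LADDER.md ## CARVER v6`, C39/C42). Carver, generation 6.

The item `Theses.SevenfoldWeilCensus.WeilSixfolds` (Weil classes on ALL complex abelian sixfolds of Weil type, every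
`K = ℚ(√-d)`, every discriminant) is, by `weilSixfolds_iff_weilClassesOf`, the conjunction over `d ≥ 1` of the `d`-SLICES

  `B_d` : for every abelian sixfold `(A, φ)` with `φ ≫ φ = -d`, every rational `(3,3)` class of `weilClassesOf A φ 3 d`
          is algebraic.

The ladder's doors (`LADDER.md` C30, C39) were typed for ALL `d` at once (`∀ d, 0 < d → …` hypotheses). Their proofs are
`d`-local, and the research input each door still lacks is ONE object PER `d` (a locally algebraic anchor / a Bloch seed).
This file records the doors ONE `d` AT A TIME, so that a single construction at one `d₀` closes `B_{d₀}` BY NAME, with the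
trust base of exactly that slice visible in the hypotheses:

* `weilSixfolds_of_forall_slice` / `weilSixfolds_slice` — the item ⟺ all its slices (bookkeeping, `weilSixfolds_iff_weilClassesOf`).
* `weilSixfolds_slice_of_hodgeConjecture` — ON-PATH: `HodgeConjecture → B_d`.
* `weilSixfolds_slice_of_splitHyperplane_four` — R2₈[d] ⟹ B_d: split `√-d`-EIGHTFOLDS give all `√-d`-sixfolds
  (`stub_descend 3 d`: partner surface + Schoen's transfer, PROVED in the tree; `WeilTypeLadderDegenerationUp.lean`).
* DOOR A[d]: `weilSixfolds_slice_of_reach_of_localAnchor_four` — `weilFamilyReach_hyperbolic` (Deligne–van Geemen reach,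
  refereed) ∧ `HasLocallyAlgebraicWeilAnchor 4 d` (ONE hyperbolic eightfold anchor, NOT in print) ⟹ `B_d`.
* DOOR A∘S[d]: `weilSixfolds_slice_of_reach_of_blochSpread_of_hyperbolicBlochSeed_four` — reach ∧ `BlochSemiregularSpread 8 4`
  (Bloch 1972 (7.4)/(7.5) = Buchweitz–Flenner 2003 Thm. 5.2, refereed) ∧ `HasHyperbolicBlochSeed 4 d` (ONE integral
  Bloch-semiregular lci on ONE hyperbolic `√-d`-eightfold carrying `q·h⁴ + w`) ⟹ `B_d`. **No preprint in the trust base,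
  for every `d`.**
* DOOR B′[d]: `weilSixfolds_slice_of_floorAt_of_reachSimilar_of_similarAnchorsAwayFromSplit` — the floor AT `d` (`F_d`:
  hyperbolic `√-d`-sixfolds) ∧ `weilFamilyReach_similar` (refereed) ∧ `HasSimilarLocallyAlgebraicWeilAnchorsAwayFromSplit 3 d`
  ⟹ `B_d`; and B′∘S[d] with `BlochSemiregularSpread 6 3` ∧ `HasSimilarBlochSeedsAwayFromSplit 3 d`. Feeders of `F_d`:
  Markman's fact (unrefereed, every `d`), Koike 2004 / Schoen 1998 (REFEREED, `d ∈ {1, 3}`,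
  `weilClasses_algebraic_hyperbolicSixfold_one_or_three_of_refereed`), reach ∧ `HasLocallyAlgebraicWeilAnchor 3 d`,
  reach ∧ `BlochSemiregularSpread 6 3` ∧ `HasHyperbolicBlochSeed 3 d`.
* Headline slices with an entirely REFEREED named-fact base: `weilSixfolds_slice_three_of_schoen1998_of_reachSimilar_of_blochSpread_of_similarBlochSeeds`
  (all `ℚ(√-3)`-sixfolds ⟸ Schoen ∧ reach-by-similitude ∧ Bloch ∧ seeds on Weil-similar anchors of the NON-split
  `ℚ(√-3)`-sixfolds) and its `ℚ(i)` twin from Koike 2004.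
* R1′ slices: `nonsplitSixfolds_slice_of_weilSixfolds_slice`, `nonsplitSixfolds_of_forall_slice`.

HONEST LABEL. Nothing is asserted; no definition; sorry-free; every door theorem is `proof.conditional` on hypotheses BY
NAME; the slices are instantiations (folklore). Score unchanged: 0 unconditional rungs above the floor. TYPE II ladder:
progress = slices / rungs proved unconditionally; a slice closed through door A∘S would be conditional on no preprint.
-/

-- every declaration of this problem lives in `Summit.HodgeConjecture.HodgeConjecture.…` (summit = sub-problem)
set_option linter.dupNamespace false

noncomputable section

open CategoryTheory AlgebraicGeometry

namespace Summit.HodgeConjecture.HodgeConjecture.WeilTypeLadder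

open Literature.AlgebraicGeometry Literature.AlgebraicGeometry.Motives
open Literature.AlgebraicGeometry.HodgeTheory
open Literature.AlgebraicTopology.SingularHomology
open Summit.HodgeConjecture.HodgeConjecture.Cruxes.HodgeAbelianVarieties.EStepSecantInduction
open Summit.HodgeConjecture.HodgeConjecture.Cruxes.HodgeAbelianVarieties.PrymCanonicalZ3SplitSeeds.Stubs.Descend
  (stub_descend)

/-! ## The item is the conjunction of its `d`-slices -/

/-- **stmt-2524 from all its `d`-slices** (`weilSixfolds_iff_weilClassesOf`, backwards). [folklore] -/
theorem weilSixfolds_of_forall_slice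
    (h : ∀ (d : ℕ), 0 < d → ∀ (A : AbelianVariety ℂ) (φ : A ⟶ A), A.dim = 2 * 3 →
      IsSmoothProjective (2 * 3) A.X → φ ≫ φ = -(d • 𝟙 A) →
        ∀ c : complexBetti A.X (2 * 3), IsRationalClass c → IsOfHodgeType (2 * 3) A.X (2 * 3) 3 3 c →
          c ∈ weilClassesOf A φ 3 d → c ∈ algebraicClasses A.X 3) :
    Theses.SevenfoldWeilCensus.WeilSixfolds :=
  weilSixfolds_iff_weilClassesOf.2 h

/-- **The `d`-slice `B_d` of stmt-2524** (`weilSixfolds_iff_weilClassesOf`, forwards, instantiated). [folklore] -/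
theorem weilSixfolds_slice (h : Theses.SevenfoldWeilCensus.WeilSixfolds) (d : ℕ) (hd : 0 < d) :
    ∀ (A : AbelianVariety ℂ) (φ : A ⟶ A), A.dim = 2 * 3 → IsSmoothProjective (2 * 3) A.X → φ ≫ φ = -(d • 𝟙 A) →
      ∀ c : complexBetti A.X (2 * 3), IsRationalClass c → IsOfHodgeType (2 * 3) A.X (2 * 3) 3 3 c →
        c ∈ weilClassesOf A φ 3 d → c ∈ algebraicClasses A.X 3 :=
  weilSixfolds_iff_weilClassesOf.1 h d hd

/-- **ON-PATH: `HodgeConjecture → B_d`** (the slice is a case of HC in bidegree `(6, 3)`). [cite: Deligne2000, §1] -/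
theorem weilSixfolds_slice_of_hodgeConjecture (h : _root_.HodgeConjecture) (d : ℕ) :
    ∀ (A : AbelianVariety ℂ) (φ : A ⟶ A), A.dim = 2 * 3 → IsSmoothProjective (2 * 3) A.X → φ ≫ φ = -(d • 𝟙 A) →
      ∀ c : complexBetti A.X (2 * 3), IsRationalClass c → IsOfHodgeType (2 * 3) A.X (2 * 3) 3 3 c →
        c ∈ weilClassesOf A φ 3 d → c ∈ algebraicClasses A.X 3 :=
  fun _ _ _ hX _ c hc h33 _ ↦ (h hX).2 3 c hc h33

/-! ## R2₈[d] ⟹ B_d: split eightfolds at `d` give all sixfolds at `d` -/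

/-- **Split `√-d`-EIGHTFOLDS give ALL `√-d`-sixfolds, one `d` at a time**: the E-step predicate
`Stubs.WeilAlgebraicSplitHyperplane 4 d` (Weil classes algebraic on the split = hyperbolic `√-d`-eightfolds, hyperplane
convention) implies `B_d`, by `stub_descend 3 d` — degeneration to `A⁶ × S²` with a complementary Weil surface and Schoen's
transfer, both PROVED in the tree (crux `HodgeAbelianVarieties`, E-step). Unconditional implication; both sides open for
`d ∉` the refereed loci. [cite: Schoen1998HodgeWeilAddendum, §10 (Proposition)] [cite: Markman2025SurveySecant, §11.5 Step 2]
[cite: vanGeemen1994HodgeAV, 5.5] -/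
theorem weilSixfolds_slice_of_splitHyperplane_four (d : ℕ) (hd : 0 < d)
    (h8 : Stubs.WeilAlgebraicSplitHyperplane (3 + 1) d) :
    ∀ (A : AbelianVariety ℂ) (φ : A ⟶ A), A.dim = 2 * 3 → IsSmoothProjective (2 * 3) A.X → φ ≫ φ = -(d • 𝟙 A) →
      ∀ c : complexBetti A.X (2 * 3), IsRationalClass c → IsOfHodgeType (2 * 3) A.X (2 * 3) 3 3 c →
        c ∈ weilClassesOf A φ 3 d → c ∈ algebraicClasses A.X 3 :=
  fun A φ hA _ hφ c hc h33 hcW ↦ stub_descend 3 d (by norm_num) hd h8 A φ hA hφ c hcW hc h33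

/-! ## DOOR A[d]: reach ∧ ONE locally algebraic hyperbolic anchor in dimension eight -/

/-- **R2₈[d] from reach and ONE anchor**: `weilFamilyReach_hyperbolic` ∧ `HasLocallyAlgebraicWeilAnchor 4 d` ⟹ Weil
classes are algebraic on every split `√-d`-eightfold (`Stubs.WeilAlgebraicSplitHyperplane 4 d`) — the `d`-slice of
`splitEightfolds_of_reach_of_localAnchor`. [cite: Deligne1982HodgeCycles, proof of Thm. 4.8]
[cite: Markman2025SecantWeil, §1.2] -/
theorem weilAlgebraicSplitHyperplane_four_of_reach_of_localAnchor (d : ℕ) (hd : 0 < d)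
    (hF : weilFamilyReach_hyperbolic) (hL : HasLocallyAlgebraicWeilAnchor 4 d) :
    Stubs.WeilAlgebraicSplitHyperplane (3 + 1) d := by
  intro B ψ e a hB hψ ha ha0 hhyp c hcW _ _
  exact weilClasses_algebraic_hyperbolic_of_localAnchor 4 d (by norm_num) hd hL hF B ψ hB hψ e a ha ha0 hhyp hcW

/-- **DOOR A[d]. All `√-d`-sixfolds from Deligne's reach and ONE locally algebraic hyperbolic anchor in dimension
EIGHT at the same `d`.** Trust base of the slice so closed: `weilFamilyReach_hyperbolic` (refereed sources) ∧ the anchor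
(research input, not in print) ∧ kernel (`stub_descend`). [cite: Deligne1982HodgeCycles, proof of Thm. 4.8]
[cite: Schoen1998HodgeWeilAddendum, §10 (Proposition)] [cite: Markman2025SecantWeil, §1.2] -/
theorem weilSixfolds_slice_of_reach_of_localAnchor_four (d : ℕ) (hd : 0 < d)
    (hF : weilFamilyReach_hyperbolic) (hL : HasLocallyAlgebraicWeilAnchor 4 d) :
    ∀ (A : AbelianVariety ℂ) (φ : A ⟶ A), A.dim = 2 * 3 → IsSmoothProjective (2 * 3) A.X → φ ≫ φ = -(d • 𝟙 A) →
      ∀ c : complexBetti A.X (2 * 3), IsRationalClass c → IsOfHodgeType (2 * 3) A.X (2 * 3) 3 3 c →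
        c ∈ weilClassesOf A φ 3 d → c ∈ algebraicClasses A.X 3 :=
  weilSixfolds_slice_of_splitHyperplane_four d hd (weilAlgebraicSplitHyperplane_four_of_reach_of_localAnchor d hd hF hL)

/-! ## DOOR A∘S[d]: reach ∧ Bloch's semiregularity theorem ∧ ONE Bloch seed in dimension eight — no preprint -/

/-- **DOOR A∘S[d]. All `√-d`-sixfolds from Deligne's reach, Bloch's theorem `BlochSemiregularSpread 8 4` and ONE
hyperbolic Bloch seed `HasHyperbolicBlochSeed 4 d`** (an integral Bloch-semiregular local complete intersection of
codimension 4 on ONE hyperbolic `√-d`-Weil eightfold, carrying `q·h⁴ + w` with `w ≠ 0` a rational Weil class). Every NAMED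
input is refereed (Deligne 1982 / van Geemen 1994; Bloch 1972 = Buchweitz–Flenner 2003 Thm. 5.2); the seed is the research
input; the rest is kernel. The `d`-slice of `weilSixfolds_of_reach_of_blochSpread_of_seeds_four`.
[cite: Bloch1972Semiregularity, Thm. (7.4) and Remark (7.5)] [cite: BuchweitzFlenner2003, Thm. 5.2]
[cite: Deligne1982HodgeCycles, proof of Thm. 4.8] [cite: Schoen1998HodgeWeilAddendum, §10 (Proposition)] -/
theorem weilSixfolds_slice_of_reach_of_blochSpread_of_hyperbolicBlochSeed_four (d : ℕ) (hd : 0 < d)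
    (hF : weilFamilyReach_hyperbolic) (hB : BlochSemiregularSpread (2 * 4) 4) (hS : HasHyperbolicBlochSeed 4 d) :
    ∀ (A : AbelianVariety ℂ) (φ : A ⟶ A), A.dim = 2 * 3 → IsSmoothProjective (2 * 3) A.X → φ ≫ φ = -(d • 𝟙 A) →
      ∀ c : complexBetti A.X (2 * 3), IsRationalClass c → IsOfHodgeType (2 * 3) A.X (2 * 3) 3 3 c →
        c ∈ weilClassesOf A φ 3 d → c ∈ algebraicClasses A.X 3 :=
  weilSixfolds_slice_of_reach_of_localAnchor_four d hd hF
    (hasLocallyAlgebraicWeilAnchor_of_blochSpread_of_hyperbolicBlochSeed hB hS)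

/-! ## DOOR B′[d]: the floor at `d` ∧ reach-by-similitude ∧ Weil-similar anchors for the non-split `√-d`-sixfolds -/

/-- **DOOR B′[d]. All `√-d`-sixfolds from the floor AT `d` (`F_d`: Weil classes algebraic on the hyperbolic
`√-d`-sixfolds), `weilFamilyReach_similar` and Weil-similar locally algebraic anchors for the NON-hyperbolic
`√-d`-sixfolds.** By cases on whether some `K`-symmetrised hyperplane class of the target is hyperbolic. The `d`-slice of
`weilSixfolds_of_floor_of_reachSimilar_of_similarAnchorsAwayFromSplit`. [cite: Deligne1982HodgeCycles, proof of Thm. 4.8]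
[cite: Schoen1998HodgeWeilAddendum, §10] [cite: vanGeemen1994HodgeAV, 5.2–5.4] -/
theorem weilSixfolds_slice_of_floorAt_of_reachSimilar_of_similarAnchorsAwayFromSplit (d : ℕ) (hd : 0 < d)
    (hF0a : ∀ (A : AbelianVariety ℂ) (φ : A ⟶ A), A.dim = 2 * 3 → IsSmoothProjective (2 * 3) A.X →
      φ ≫ φ = -(d • 𝟙 A) → ∀ (e : ProjectiveEmbedding A.X) (a : complexBetti (projectiveSpace e.n ℂ) 2),
        IsRationalClass a → a ≠ 0 →
          IsHyperbolicWeilType A φ 3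
            ((d : ℂ) • complexBetti.map e.ι 2 a + complexBetti.map φ.hom.hom.hom 2 (complexBetti.map e.ι 2 a)) →
          ∀ c : complexBetti A.X (2 * 3), IsRationalClass c → IsOfHodgeType (2 * 3) A.X (2 * 3) 3 3 c →
            c ∈ weilClassesOf A φ 3 d → c ∈ algebraicClasses A.X 3)
    (hF : weilFamilyReach_similar) (hS : HasSimilarLocallyAlgebraicWeilAnchorsAwayFromSplit 3 d) :
    ∀ (A : AbelianVariety ℂ) (φ : A ⟶ A), A.dim = 2 * 3 → IsSmoothProjective (2 * 3) A.X → φ ≫ φ = -(d • 𝟙 A) →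
      ∀ c : complexBetti A.X (2 * 3), IsRationalClass c → IsOfHodgeType (2 * 3) A.X (2 * 3) 3 3 c →
        c ∈ weilClassesOf A φ 3 d → c ∈ algebraicClasses A.X 3 := by
  intro A φ hA hX hφ c hc h33 hcW
  by_cases hc0 : c = 0
  · rw [hc0]; exact Submodule.zero_mem _
  by_cases hhyp : ∃ (e : ProjectiveEmbedding A.X) (a : complexBetti (projectiveSpace e.n ℂ) 2),
      IsRationalClass a ∧ a ≠ 0 ∧
        IsHyperbolicWeilType A φ 3
          ((d : ℂ) • complexBetti.map e.ι 2 a + complexBetti.map φ.hom.hom.hom 2 (complexBetti.map e.ι 2 a))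
  · obtain ⟨e, a, ha, ha0, hh⟩ := hhyp
    exact hF0a A φ hA hX hφ e a ha ha0 hh c hc h33 hcW
  · exact weilClassesOf_le_algebraicClasses_of_reachSimilar_of_similarAnchor hF (by norm_num) hd A φ hA hφ
      ⟨c, hcW, hc0, h33⟩
      (hS A φ hA hφ (fun e a ha ha0 hh ↦ hhyp ⟨e, a, ha, ha0, hh⟩) ⟨c, hcW, hc0, h33⟩) hcW

/-- **DOOR B′∘S[d]**: the same with the Weil-similar anchors fed by Bloch seeds — `F_d` ∧ `weilFamilyReach_similar` ∧
`BlochSemiregularSpread 6 3` ∧ `HasSimilarBlochSeedsAwayFromSplit 3 d` ⟹ `B_d`.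
[cite: Bloch1972Semiregularity, Thm. (7.4) and Remark (7.5)] [cite: BuchweitzFlenner2003, Thm. 5.2]
[cite: Deligne1982HodgeCycles, proof of Thm. 4.8] [cite: Schoen1998HodgeWeilAddendum, §10] -/
theorem weilSixfolds_slice_of_floorAt_of_reachSimilar_of_blochSpread_of_similarBlochSeeds (d : ℕ) (hd : 0 < d)
    (hF0a : ∀ (A : AbelianVariety ℂ) (φ : A ⟶ A), A.dim = 2 * 3 → IsSmoothProjective (2 * 3) A.X →
      φ ≫ φ = -(d • 𝟙 A) → ∀ (e : ProjectiveEmbedding A.X) (a : complexBetti (projectiveSpace e.n ℂ) 2),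
        IsRationalClass a → a ≠ 0 →
          IsHyperbolicWeilType A φ 3
            ((d : ℂ) • complexBetti.map e.ι 2 a + complexBetti.map φ.hom.hom.hom 2 (complexBetti.map e.ι 2 a)) →
          ∀ c : complexBetti A.X (2 * 3), IsRationalClass c → IsOfHodgeType (2 * 3) A.X (2 * 3) 3 3 c →
            c ∈ weilClassesOf A φ 3 d → c ∈ algebraicClasses A.X 3)
    (hF : weilFamilyReach_similar) (hB : BlochSemiregularSpread (2 * 3) 3)
    (hS : HasSimilarBlochSeedsAwayFromSplit 3 d) :
    ∀ (A : AbelianVariety ℂ) (φ : A ⟶ A), A.dim = 2 * 3 → IsSmoothProjective (2 * 3) A.X → φ ≫ φ = -(d • 𝟙 A) →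
      ∀ c : complexBetti A.X (2 * 3), IsRationalClass c → IsOfHodgeType (2 * 3) A.X (2 * 3) 3 3 c →
        c ∈ weilClassesOf A φ 3 d → c ∈ algebraicClasses A.X 3 :=
  weilSixfolds_slice_of_floorAt_of_reachSimilar_of_similarAnchorsAwayFromSplit d hd hF0a hF
    (hasSimilarLocallyAlgebraicWeilAnchorsAwayFromSplit_of_blochSpread_of_similarBlochSeeds hB hS)

/-! ## Feeders of the floor slice `F_d` -/

/-- `F_d` from Markman's fact (every `d`; UNREFEREED preprint). [claim: Markman2025SecantWeil, status: under-review, Thm. 1.5.1] -/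
theorem floorAt_of_markman2025 (hM : Markman2025_weilClasses_algebraic_hyperbolicSixfold) (d : ℕ) (hd : 0 < d) :
    ∀ (A : AbelianVariety ℂ) (φ : A ⟶ A), A.dim = 2 * 3 → IsSmoothProjective (2 * 3) A.X →
      φ ≫ φ = -(d • 𝟙 A) → ∀ (e : ProjectiveEmbedding A.X) (a : complexBetti (projectiveSpace e.n ℂ) 2),
        IsRationalClass a → a ≠ 0 →
          IsHyperbolicWeilType A φ 3
            ((d : ℂ) • complexBetti.map e.ι 2 a + complexBetti.map φ.hom.hom.hom 2 (complexBetti.map e.ι 2 a)) →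
          ∀ c : complexBetti A.X (2 * 3), IsRationalClass c → IsOfHodgeType (2 * 3) A.X (2 * 3) 3 3 c →
            c ∈ weilClassesOf A φ 3 d → c ∈ algebraicClasses A.X 3 :=
  hM d hd

/-- `F_d` for `d ∈ {1, 3}` from REFEREED facts (Koike 2004, Schoen 1998).
[cite: Koike2004WeilHodge, Cor. 2.1] [cite: Schoen1998HodgeWeilAddendum, §§11–13] -/
theorem floorAt_of_refereed_one_or_three (hK : Koike2004_weilClasses_algebraic_hyperbolicSixfold_one)
    (hS : Schoen1998_weilClasses_algebraic_hyperbolicSixfold_three) (d : ℕ) (hd : d = 1 ∨ d = 3) :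
    ∀ (A : AbelianVariety ℂ) (φ : A ⟶ A), A.dim = 2 * 3 → IsSmoothProjective (2 * 3) A.X →
      φ ≫ φ = -(d • 𝟙 A) → ∀ (e : ProjectiveEmbedding A.X) (a : complexBetti (projectiveSpace e.n ℂ) 2),
        IsRationalClass a → a ≠ 0 →
          IsHyperbolicWeilType A φ 3
            ((d : ℂ) • complexBetti.map e.ι 2 a + complexBetti.map φ.hom.hom.hom 2 (complexBetti.map e.ι 2 a)) →
          ∀ c : complexBetti A.X (2 * 3), IsRationalClass c → IsOfHodgeType (2 * 3) A.X (2 * 3) 3 3 c →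
            c ∈ weilClassesOf A φ 3 d → c ∈ algebraicClasses A.X 3 :=
  weilClasses_algebraic_hyperbolicSixfold_one_or_three_of_refereed hK hS d hd

/-- `F_d` from reach and ONE locally algebraic hyperbolic anchor in dimension six at `d` (door A at the floor, sliced).
[cite: Deligne1982HodgeCycles, proof of Thm. 4.8] [cite: Markman2025SecantWeil, Thm. 1.5.1] -/
theorem floorAt_of_reach_of_localAnchor_three (d : ℕ) (hd : 0 < d) (hF : weilFamilyReach_hyperbolic)
    (hL : HasLocallyAlgebraicWeilAnchor 3 d) :
    ∀ (A : AbelianVariety ℂ) (φ : A ⟶ A), A.dim = 2 * 3 → IsSmoothProjective (2 * 3) A.X →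
      φ ≫ φ = -(d • 𝟙 A) → ∀ (e : ProjectiveEmbedding A.X) (a : complexBetti (projectiveSpace e.n ℂ) 2),
        IsRationalClass a → a ≠ 0 →
          IsHyperbolicWeilType A φ 3
            ((d : ℂ) • complexBetti.map e.ι 2 a + complexBetti.map φ.hom.hom.hom 2 (complexBetti.map e.ι 2 a)) →
          ∀ c : complexBetti A.X (2 * 3), IsRationalClass c → IsOfHodgeType (2 * 3) A.X (2 * 3) 3 3 c →
            c ∈ weilClassesOf A φ 3 d → c ∈ algebraicClasses A.X 3 :=
  fun A φ hA _ hφ e a ha ha0 hhyp c _ _ hcW ↦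
    weilClasses_algebraic_hyperbolic_of_localAnchor 3 d (by norm_num) hd hL hF A φ hA hφ e a ha ha0 hhyp hcW

/-- `F_d` from reach, Bloch's theorem `BlochSemiregularSpread 6 3` and ONE hyperbolic Bloch seed in dimension six at `d`.
[cite: Bloch1972Semiregularity, Thm. (7.4) and Remark (7.5)] [cite: Deligne1982HodgeCycles, proof of Thm. 4.8] -/
theorem floorAt_of_reach_of_blochSpread_of_hyperbolicBlochSeed_three (d : ℕ) (hd : 0 < d)
    (hF : weilFamilyReach_hyperbolic) (hB : BlochSemiregularSpread (2 * 3) 3) (hS : HasHyperbolicBlochSeed 3 d) :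
    ∀ (A : AbelianVariety ℂ) (φ : A ⟶ A), A.dim = 2 * 3 → IsSmoothProjective (2 * 3) A.X →
      φ ≫ φ = -(d • 𝟙 A) → ∀ (e : ProjectiveEmbedding A.X) (a : complexBetti (projectiveSpace e.n ℂ) 2),
        IsRationalClass a → a ≠ 0 →
          IsHyperbolicWeilType A φ 3
            ((d : ℂ) • complexBetti.map e.ι 2 a + complexBetti.map φ.hom.hom.hom 2 (complexBetti.map e.ι 2 a)) →
          ∀ c : complexBetti A.X (2 * 3), IsRationalClass c → IsOfHodgeType (2 * 3) A.X (2 * 3) 3 3 c →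
            c ∈ weilClassesOf A φ 3 d → c ∈ algebraicClasses A.X 3 :=
  floorAt_of_reach_of_localAnchor_three d hd hF (hasLocallyAlgebraicWeilAnchor_of_blochSpread_of_hyperbolicBlochSeed hB hS)

/-! ## Headline slices whose named-fact base is entirely REFEREED -/

/-- **All `ℚ(√-3)`-sixfolds ⟸ Schoen 1998 (split `ℚ(√-3)`-sixfolds, refereed) ∧ reach-by-similitude (refereed) ∧
Bloch's theorem (refereed) ∧ Bloch seeds on Weil-similar anchors of the NON-split `ℚ(√-3)`-sixfolds** (the research
input). [cite: Schoen1998HodgeWeilAddendum, §§10–13] [cite: Bloch1972Semiregularity, Thm. (7.4) and Remark (7.5)]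
[cite: Deligne1982HodgeCycles, proof of Thm. 4.8] -/
theorem weilSixfolds_slice_three_of_schoen1998_of_reachSimilar_of_blochSpread_of_similarBlochSeeds
    (hSch : Schoen1998_weilClasses_algebraic_hyperbolicSixfold_three) (hF : weilFamilyReach_similar)
    (hB : BlochSemiregularSpread (2 * 3) 3) (hS : HasSimilarBlochSeedsAwayFromSplit 3 3) :
    ∀ (A : AbelianVariety ℂ) (φ : A ⟶ A), A.dim = 2 * 3 → IsSmoothProjective (2 * 3) A.X → φ ≫ φ = -((3 : ℕ) • 𝟙 A) →
      ∀ c : complexBetti A.X (2 * 3), IsRationalClass c → IsOfHodgeType (2 * 3) A.X (2 * 3) 3 3 c →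
        c ∈ weilClassesOf A φ 3 3 → c ∈ algebraicClasses A.X 3 :=
  weilSixfolds_slice_of_floorAt_of_reachSimilar_of_blochSpread_of_similarBlochSeeds 3 (by norm_num)
    (fun A φ hA hX hφ e a ha ha0 hh c hc h33 hcW ↦ hSch A φ hA hX hφ e a ha ha0 hh c hc h33 hcW) hF hB hS

/-- **All `ℚ(i)`-sixfolds ⟸ Koike 2004 (split `ℚ(i)`-sixfolds, refereed) ∧ reach-by-similitude ∧ Bloch's theorem ∧
Bloch seeds on Weil-similar anchors of the NON-split `ℚ(i)`-sixfolds.** [cite: Koike2004WeilHodge, Cor. 2.1]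
[cite: Bloch1972Semiregularity, Thm. (7.4) and Remark (7.5)] [cite: Deligne1982HodgeCycles, proof of Thm. 4.8] -/
theorem weilSixfolds_slice_one_of_koike2004_of_reachSimilar_of_blochSpread_of_similarBlochSeeds
    (hK : Koike2004_weilClasses_algebraic_hyperbolicSixfold_one) (hF : weilFamilyReach_similar)
    (hB : BlochSemiregularSpread (2 * 3) 3) (hS : HasSimilarBlochSeedsAwayFromSplit 3 1) :
    ∀ (A : AbelianVariety ℂ) (φ : A ⟶ A), A.dim = 2 * 3 → IsSmoothProjective (2 * 3) A.X → φ ≫ φ = -((1 : ℕ) • 𝟙 A) →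
      ∀ c : complexBetti A.X (2 * 3), IsRationalClass c → IsOfHodgeType (2 * 3) A.X (2 * 3) 3 3 c →
        c ∈ weilClassesOf A φ 3 1 → c ∈ algebraicClasses A.X 3 :=
  weilSixfolds_slice_of_floorAt_of_reachSimilar_of_blochSpread_of_similarBlochSeeds 1 (by norm_num)
    (fun A φ hA hX hφ e a ha ha0 hh c hc h33 hcW ↦ hK A φ hA hX hφ e a ha ha0 hh c hc h33 hcW) hF hB hS

/-! ## R1′ slices -/

/-- **The `d`-slice of R1′ (`NonsplitSixfolds`) from `B_d`** (restriction to the non-hyperbolic sixfolds). [folklore] -/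
theorem nonsplitSixfolds_slice_of_weilSixfolds_slice (d : ℕ)
    (h : ∀ (A : AbelianVariety ℂ) (φ : A ⟶ A), A.dim = 2 * 3 → IsSmoothProjective (2 * 3) A.X → φ ≫ φ = -(d • 𝟙 A) →
      ∀ c : complexBetti A.X (2 * 3), IsRationalClass c → IsOfHodgeType (2 * 3) A.X (2 * 3) 3 3 c →
        c ∈ weilClassesOf A φ 3 d → c ∈ algebraicClasses A.X 3) :
    ∀ (A : AbelianVariety ℂ) (φ : A ⟶ A), A.dim = 2 * 3 → IsSmoothProjective (2 * 3) A.X → φ ≫ φ = -(d • 𝟙 A) →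
      (∀ (e : ProjectiveEmbedding A.X) (a : complexBetti (projectiveSpace e.n ℂ) 2), IsRationalClass a → a ≠ 0 →
        ¬ IsHyperbolicWeilType A φ 3
          ((d : ℂ) • complexBetti.map e.ι 2 a + complexBetti.map φ.hom.hom.hom 2 (complexBetti.map e.ι 2 a))) →
      ∀ c : complexBetti A.X (2 * 3), IsRationalClass c → IsOfHodgeType (2 * 3) A.X (2 * 3) 3 3 c →
        c ∈ weilClassesOf A φ 3 d → c ∈ algebraicClasses A.X 3 :=
  fun A φ hA hX hφ _ c hc h33 hcW ↦ h A φ hA hX hφ c hc h33 hcW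

/-- **R1′ from all its `d`-slices.** [folklore] -/
theorem nonsplitSixfolds_of_forall_slice
    (h : ∀ (d : ℕ), 0 < d → ∀ (A : AbelianVariety ℂ) (φ : A ⟶ A), A.dim = 2 * 3 → IsSmoothProjective (2 * 3) A.X →
      φ ≫ φ = -(d • 𝟙 A) →
        (∀ (e : ProjectiveEmbedding A.X) (a : complexBetti (projectiveSpace e.n ℂ) 2), IsRationalClass a → a ≠ 0 →
          ¬ IsHyperbolicWeilType A φ 3
            ((d : ℂ) • complexBetti.map e.ι 2 a + complexBetti.map φ.hom.hom.hom 2 (complexBetti.map e.ι 2 a))) →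
        ∀ c : complexBetti A.X (2 * 3), IsRationalClass c → IsOfHodgeType (2 * 3) A.X (2 * 3) 3 3 c →
          c ∈ weilClassesOf A φ 3 d → c ∈ algebraicClasses A.X 3) :
    NonsplitSixfolds :=
  fun d hd ↦ h d hd

/-- **R1′[d] through DOOR A∘S[d]** — no preprint in the trust base. [cite: Bloch1972Semiregularity, Thm. (7.4) and Remark (7.5)]
[cite: Deligne1982HodgeCycles, proof of Thm. 4.8] [cite: Schoen1998HodgeWeilAddendum, §10 (Proposition)] -/
theorem nonsplitSixfolds_slice_of_reach_of_blochSpread_of_hyperbolicBlochSeed_four (d : ℕ) (hd : 0 < d)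
    (hF : weilFamilyReach_hyperbolic) (hB : BlochSemiregularSpread (2 * 4) 4) (hS : HasHyperbolicBlochSeed 4 d) :
    ∀ (A : AbelianVariety ℂ) (φ : A ⟶ A), A.dim = 2 * 3 → IsSmoothProjective (2 * 3) A.X → φ ≫ φ = -(d • 𝟙 A) →
      (∀ (e : ProjectiveEmbedding A.X) (a : complexBetti (projectiveSpace e.n ℂ) 2), IsRationalClass a → a ≠ 0 →
        ¬ IsHyperbolicWeilType A φ 3
          ((d : ℂ) • complexBetti.map e.ι 2 a + complexBetti.map φ.hom.hom.hom 2 (complexBetti.map e.ι 2 a))) →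
      ∀ c : complexBetti A.X (2 * 3), IsRationalClass c → IsOfHodgeType (2 * 3) A.X (2 * 3) 3 3 c →
        c ∈ weilClassesOf A φ 3 d → c ∈ algebraicClasses A.X 3 :=
  nonsplitSixfolds_slice_of_weilSixfolds_slice d
    (weilSixfolds_slice_of_reach_of_blochSpread_of_hyperbolicBlochSeed_four d hd hF hB hS)

end Summit.HodgeConjecture.HodgeConjecture.WeilTypeLadder

end
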